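import Summits.NavierStokesRegularity.NavierStokesRegularity.Theorems.PlaneEnergyCeilingPlanarEnergyLiouvilleOfNoLocalTypeI
import Literature.Analysis.FluidPDE.MorreyLargeScale
import Literature.Analysis.FluidPDE.OseenDuhamelPairCalculus
import HarnessLib

/-!
# `PlanarEnergyLiouville`: the small-planar-energy corner, unconditionally

Route `PlaneEnergyCeiling`, crux `PlanarEnergyLiouville` (stmt-NavierStokesRegularity-16856):

> every bounded ancient mild solution (`ν = 1`), with measurable slices, jointly smooth on
> `(−∞,0) × ℝ³`, whose planar kinetic energies `∫_{R({x₂=c})} ‖v(t)‖²` are bounded by one constant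
> `M` on every plane and every slice, vanishes identically.

This file proves the crux in the **perturbative corner**: there is an ABSOLUTE constant `ε > 0`
such that the conclusion holds whenever the planar bound satisfies `M ≤ ε`
(`planarEnergyLiouville_smallCorner`, registered sub-goal of the crux item). Together with the `L³`/finite-energy corner
(`PlaneEnergyCeilingPlanarEnergyLiouvilleL3Corner`) and the steady corner (`SteadyPlanarLiouville`)
this exhausts the cases of the crux that follow from the printed theory; the general case is the
Type-I anchoring problem recorded in `PlaneEnergyCeilingPlanarEnergyLiouvilleOfNoLocalTypeI`.

## Proof

1. *Morrey bound.* The planar ceiling gives `∫_{B_r(y)} ‖v(t)‖² ≤ 2 M r` for all slices, centres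
   and radii (`planeEnergyCeiling_scaledEnergyOfPlanar`), hence the `L¹` form
   `∫_{B_r(y)} ‖v(t)‖ ≤ √(V₁ 2M) r²` (`setLIntegral_enorm_ball_le_of_morrey`).
2. *Oseen representation.* The crux class solves the Oseen integral equation
   `v(t) = e^{σΔ} v(t−σ) − B_{t−σ}(v,v)(t)` for every `σ > 0`
   (`oseenMild_and_morrey_of_planar`; KNSS 2009, Lemma 3.1, the Morrey bound kills the drift).
3. *Two kernel bounds.* `‖e^{σΔ} v(t−σ)(x)‖ ≤ C_h √(V₁ 2M)/√σ` (caloric smoothing of Morrey data,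
   `norm_heatExtension_origin_le_of_morrey`, after translating to the origin) and
   `‖B_{t−σ}(v,v)(t)(x)‖ ≤ C₀ W² · 2√σ` whenever `‖v‖ ≤ W` on `(t−σ,t)` (KNSS 2009, §4,
   `norm_oseenDuhamel_le_const`).
4. *Contraction.* With `A = C_h √(2V₁) √M`, `B = 2C₀` and the choice `√σ = 1/(2BW)`, any bound
   `‖v‖ ≤ W` improves to `‖v‖ ≤ (2AB + 1/2) W`. If `2AB ≤ 1/4`, i.e. `M ≤ ε := 1/(128 C_h² V₁ C₀²)`,
   then `‖v‖ ≤ (3/4)ⁿ W₀` for every `n`, so `v ≡ 0`.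

This is the scale-invariant small-data Liouville theorem in the Morrey class `Ṁ^{2,1} ∋ v(t)`
(the planar bound is a scale-invariant quantity; boundedness of `v` is used only qualitatively).

## References

* G. Koch, N. Nadirashvili, G. Seregin, V. Šverák, *Liouville theorems for the Navier–Stokes
  equations and applications*, Acta Math. 203 (2009), Lemma 3.1 and §4 (arXiv:0709.3599).
  [KochNadirashviliSereginSverak2009]
-/

-- Sub = summit for this single-conjunct summit: the duplicate namespace component is deliberate.
set_option linter.dupNamespace false

noncomputable section

open MeasureTheory Set Filter Metric Function Real
open _root_.Topology
open scoped ENNReal NNReal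
open Literature.Analysis Literature.Analysis.FluidPDE

namespace Summit.NavierStokesRegularity.NavierStokesRegularity.Theorems.PlaneEnergyCeilingPlanarEnergyLiouville

/-! ### Kernel bounds at a general point -/

/-- **The caloric extension commutes with translations** (the heat kernel is a convolution kernel):
`(e^{ρΔ} f)(x) = e^{ρΔ}(f(· + x))(0)`, for every `ρ` (both sides are the same integral). [folklore] -/
theorem heatExtension_eq_heatExtension_translate_zero
    {F : Type*} [NormedAddCommGroup F] [NormedSpace ℝ F]
    (f : EuclideanSpace ℝ (Fin 3) → F) (ρ : ℝ) (x : EuclideanSpace ℝ (Fin 3)) :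
    UnboundedOperators.heatExtension f ρ x =
      UnboundedOperators.heatExtension (fun y => f (y + x)) ρ 0 := by
  rw [UnboundedOperators.heatExtension_apply, UnboundedOperators.heatExtension_apply]
  congr 1
  funext z
  rw [zero_sub, neg_add_eq_sub]

/-- **Translating a Morrey bound to the origin**: if `∫⁻_{B_r(y)} ‖w‖ₑ² ≤ I r` at every centre,
then the translate `w(· + x)` satisfies `∫⁻_{B_r(0)} ‖w(· + x)‖ₑ² ≤ I r`. [folklore] -/
theorem lintegral_ball_zero_translate_le {w : EuclideanSpace ℝ (Fin 3) → EuclideanSpace ℝ (Fin 3)}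
    {I : ℝ} (hMor : ∀ (y : EuclideanSpace ℝ (Fin 3)) (r : ℝ), 0 < r →
      ∫⁻ z in ball y r, ‖w z‖ₑ ^ 2 ≤ ENNReal.ofReal (I * r))
    (x : EuclideanSpace ℝ (Fin 3)) {r : ℝ} (hr : 0 < r) :
    ∫⁻ z in ball (0 : EuclideanSpace ℝ (Fin 3)) r, ‖w (z + x)‖ₑ ^ 2 ≤ ENNReal.ofReal (I * r) := by
  have hmp : MeasurePreserving (fun z : EuclideanSpace ℝ (Fin 3) => z + x) volume volume :=
    measurePreserving_add_right volume x
  have hemb : MeasurableEmbedding (fun z : EuclideanSpace ℝ (Fin 3) => z + x) :=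
    (Homeomorph.addRight x).measurableEmbedding
  have hpre : (fun z : EuclideanSpace ℝ (Fin 3) => z + x) ⁻¹' ball x r = ball 0 r := by
    ext z
    simp [Metric.mem_ball, dist_eq_norm]
  have key := hmp.setLIntegral_comp_preimage_emb hemb (fun z => ‖w z‖ₑ ^ 2) (ball x r)
  rw [hpre] at key
  rw [key]
  exact hMor x r hr

/-- **Caloric smoothing of Morrey data, at every point.** If a measurable field `w` on `ℝ³` obeys
`∫⁻_{B_r(y)} ‖w‖ₑ² ≤ I r` for all centres and radii (`I ≥ 0`), then for every `ρ > 0` and `x`,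
`‖(e^{ρΔ} w)(x)‖ ≤ 2048 (4π)^{-3/2} √(V₁ I)/√ρ`, `V₁ = |B₁|` (Cauchy–Schwarz to the `L¹`-Morrey
bound, then the dyadic Gaussian estimate `norm_heatExtension_origin_le_of_morrey`). [folklore] -/
theorem norm_heatExtension_le_of_morrey {w : EuclideanSpace ℝ (Fin 3) → EuclideanSpace ℝ (Fin 3)}
    (hw : AEStronglyMeasurable w volume) {I : ℝ} (hI : 0 ≤ I)
    (hMor : ∀ (y : EuclideanSpace ℝ (Fin 3)) (r : ℝ), 0 < r →
      ∫⁻ z in ball y r, ‖w z‖ₑ ^ 2 ≤ ENNReal.ofReal (I * r))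
    {ρ : ℝ} (hρ : 0 < ρ) (x : EuclideanSpace ℝ (Fin 3)) :
    ‖UnboundedOperators.heatExtension w ρ x‖ ≤
      2048 * (4 * Real.pi) ^ (-(3 : ℝ) / 2) *
        Real.sqrt ((volume (ball (0 : EuclideanSpace ℝ (Fin 3)) 1)).toReal * I) / Real.sqrt ρ := by
  rw [heatExtension_eq_heatExtension_translate_zero]
  have hwx : AEStronglyMeasurable (fun y => w (y + x)) volume :=
    hw.comp_measurePreserving (measurePreserving_add_right volume x)
  refine norm_heatExtension_origin_le_of_morrey hρ (Real.sqrt_nonneg _) fun r hr => ?_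
  have hr0 : 0 < r := lt_of_lt_of_le (Real.sqrt_pos.2 hρ) hr
  exact setLIntegral_enorm_ball_le_of_morrey hwx hI hr0 (lintegral_ball_zero_translate_le hMor x hr0)

/-! ### The contraction -/

/-- **One step of the contraction.** Let `v` solve the Oseen integral equation between all pairs of
negative times, with measurable slices obeying the Morrey bound `∫⁻_{B_r(y)} ‖v(t)‖ₑ² ≤ I r`, and
suppose `‖v‖ ≤ W` on `(−∞,0) × ℝ³`. Then `‖v‖ ≤ (K √I + 1/2) W` with the absolute constant
`K = 4 · 2048 (4π)^{-3/2} √V₁ · C₀` (`C₀ = oseenSliceConst`): split `v(t) = e^{σΔ}v(t−σ) − B(v,v)`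
with `√σ = 1/(4 C₀ W)`. [cite: KochNadirashviliSereginSverak2009, Lemma 3.1 and §4 p. 8] -/
theorem norm_le_contract_of_oseen_morrey
    {v : ℝ → EuclideanSpace ℝ (Fin 3) → EuclideanSpace ℝ (Fin 3)}
    (hrep : ∀ s t : ℝ, s < t → t < 0 → ∀ x,
      v t x = UnboundedOperators.heatExtension (v s) (t - s) x - oseenDuhamel 1 s v v t x)
    (hmeas : ∀ t < 0, AEStronglyMeasurable (v t) volume)
    {I : ℝ} (hI : 0 ≤ I)
    (hMor : ∀ t < 0, ∀ (y : EuclideanSpace ℝ (Fin 3)) (r : ℝ), 0 < r →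
      ∫⁻ z in ball y r, ‖v t z‖ₑ ^ 2 ≤ ENNReal.ofReal (I * r))
    {W : ℝ} (hW : ∀ t < 0, ∀ x, ‖v t x‖ ≤ W) :
    ∀ t < 0, ∀ x, ‖v t x‖ ≤
      (4 * (2048 * (4 * Real.pi) ^ (-(3 : ℝ) / 2) *
          Real.sqrt ((volume (ball (0 : EuclideanSpace ℝ (Fin 3)) 1)).toReal)) *
        oseenSliceConst (EuclideanSpace ℝ (Fin 3)) * Real.sqrt I + 1 / 2) * W := by
  intro t ht x
  set Ch : ℝ := 2048 * (4 * Real.pi) ^ (-(3 : ℝ) / 2) *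
    Real.sqrt ((volume (ball (0 : EuclideanSpace ℝ (Fin 3)) 1)).toReal) with hCh
  set C₀ : ℝ := oseenSliceConst (EuclideanSpace ℝ (Fin 3)) with hC₀
  have hC₀pos : 0 < C₀ := oseenSliceConst_pos
  have hChnn : 0 ≤ Ch := by positivity
  have hW0 : 0 ≤ W := (norm_nonneg _).trans (hW t ht x)
  rcases hW0.eq_or_lt with hW0 | hWpos
  · -- `W = 0`: nothing to improve
    rw [← hW0, mul_zero]
    simpa [← hW0] using hW t ht x
  -- `W > 0`: split at `s = t - σ`, `√σ = 1/(4 C₀ W)`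
  set a : ℝ := 1 / (4 * C₀ * W) with ha
  have hapos : 0 < a := by positivity
  set σ : ℝ := a ^ 2 with hσ
  have hσpos : 0 < σ := by positivity
  have hsqσ : Real.sqrt σ = a := by rw [hσ, Real.sqrt_sq hapos.le]
  set s : ℝ := t - σ with hs
  have hst : s < t := by rw [hs]; linarith
  have hs0 : s < 0 := hst.trans ht
  have hts : t - s = σ := by rw [hs]; ring
  -- the heat term
  have hheat : ‖UnboundedOperators.heatExtension (v s) (t - s) x‖ ≤ Ch * Real.sqrt I / a := by
    rw [hts]
    have h := norm_heatExtension_le_of_morrey (hmeas s hs0) hI (hMor s hs0) hσpos x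
    rw [hsqσ, Real.sqrt_mul ENNReal.toReal_nonneg] at h
    calc ‖UnboundedOperators.heatExtension (v s) σ x‖
        ≤ 2048 * (4 * Real.pi) ^ (-(3 : ℝ) / 2) *
            (Real.sqrt ((volume (ball (0 : EuclideanSpace ℝ (Fin 3)) 1)).toReal) * Real.sqrt I) / a := h
      _ = Ch * Real.sqrt I / a := by rw [hCh]; ring
  -- the Duhamel term
  have hduh : ‖oseenDuhamel 1 s v v t x‖ ≤ C₀ * (W * W) * (2 * a) := by
    have h := norm_oseenDuhamel_le_const (E := EuclideanSpace ℝ (Fin 3)) hst.le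
      (a := v) (b := v) (Ma := W) (Mb := W)
      (fun τ hτ y => hW τ (hτ.2.trans ht) y) (fun τ hτ y => hW τ (hτ.2.trans ht) y) x
    rwa [hts, hsqσ] at h
  -- assemble
  have hsplit : ‖v t x‖ ≤ Ch * Real.sqrt I / a + C₀ * (W * W) * (2 * a) := by
    rw [hrep s t hst ht x]
    exact (norm_sub_le _ _).trans (add_le_add hheat hduh)
  have hkey : Ch * Real.sqrt I / a + C₀ * (W * W) * (2 * a) =
      (4 * Ch * C₀ * Real.sqrt I + 1 / 2) * W := by
    rw [ha]
    field_simp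
    ring
  calc ‖v t x‖ ≤ Ch * Real.sqrt I / a + C₀ * (W * W) * (2 * a) := hsplit
    _ = (4 * Ch * C₀ * Real.sqrt I + 1 / 2) * W := hkey
    _ = (4 * Ch * oseenSliceConst (EuclideanSpace ℝ (Fin 3)) * Real.sqrt I + 1 / 2) * W := by
        rw [hC₀]

/-- **Iterating the contraction.** Under the hypotheses of `norm_le_contract_of_oseen_morrey`, if
the Morrey constant is so small that `K √I ≤ 1/4`, then every bound `‖v‖ ≤ W₀` improves to
`‖v‖ ≤ (3/4)ⁿ W₀` for all `n`. [folklore] -/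
theorem norm_le_pow_of_oseen_morrey
    {v : ℝ → EuclideanSpace ℝ (Fin 3) → EuclideanSpace ℝ (Fin 3)}
    (hrep : ∀ s t : ℝ, s < t → t < 0 → ∀ x,
      v t x = UnboundedOperators.heatExtension (v s) (t - s) x - oseenDuhamel 1 s v v t x)
    (hmeas : ∀ t < 0, AEStronglyMeasurable (v t) volume)
    {I : ℝ} (hI : 0 ≤ I)
    (hMor : ∀ t < 0, ∀ (y : EuclideanSpace ℝ (Fin 3)) (r : ℝ), 0 < r →
      ∫⁻ z in ball y r, ‖v t z‖ₑ ^ 2 ≤ ENNReal.ofReal (I * r))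
    (hsmall : 4 * (2048 * (4 * Real.pi) ^ (-(3 : ℝ) / 2) *
          Real.sqrt ((volume (ball (0 : EuclideanSpace ℝ (Fin 3)) 1)).toReal)) *
        oseenSliceConst (EuclideanSpace ℝ (Fin 3)) * Real.sqrt I ≤ 1 / 4)
    {W₀ : ℝ} (hW₀ : ∀ t < 0, ∀ x, ‖v t x‖ ≤ W₀) :
    ∀ n : ℕ, ∀ t < 0, ∀ x, ‖v t x‖ ≤ (3 / 4 : ℝ) ^ n * W₀ := by
  intro n
  induction n with
  | zero => simpa using hW₀
  | succ n ih =>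
      intro t ht x
      have hW0 : 0 ≤ (3 / 4 : ℝ) ^ n * W₀ := (norm_nonneg _).trans (ih t ht x)
      have h := norm_le_contract_of_oseen_morrey hrep hmeas hI hMor ih t ht x
      refine h.trans ?_
      rw [pow_succ]
      calc (4 * (2048 * (4 * Real.pi) ^ (-(3 : ℝ) / 2) *
              Real.sqrt ((volume (ball (0 : EuclideanSpace ℝ (Fin 3)) 1)).toReal)) *
            oseenSliceConst (EuclideanSpace ℝ (Fin 3)) * Real.sqrt I + 1 / 2) * ((3 / 4 : ℝ) ^ n * W₀)
          ≤ (1 / 4 + 1 / 2) * ((3 / 4 : ℝ) ^ n * W₀) := by gcongr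
        _ = (3 / 4 : ℝ) ^ n * (3 / 4) * W₀ := by ring

/-! ### The corner theorem -/

/-- **`PlanarEnergyLiouville` for small planar energies (unconditional).** There is an absolute
constant `ε > 0` such that: every bounded ancient mild solution (`ν = 1`, KNSS duality class) with
measurable slices, jointly smooth on `(−∞,0) × ℝ³`, whose planar kinetic energies are bounded by
`M ≤ ε` on every plane `R({x₂ = c})` and every slice `t < 0`, vanishes identically. (Planar
ceiling ⇒ Morrey bound `2M` ⇒ Oseen representation; caloric smoothing of Morrey data and the KNSS
bilinear bound make `W ↦ (K√(2M) + 1/2) W` a contraction on the sup bounds of `v`.)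
[cite: KochNadirashviliSereginSverak2009, Lemma 3.1 and §4] -/
theorem planarEnergyLiouville_smallCorner :
    ∃ ε : ℝ, 0 < ε ∧ ∀ (v : ℝ → EuclideanSpace ℝ (Fin 3) → EuclideanSpace ℝ (Fin 3)),
      Literature.Analysis.FluidPDE.IsBoundedAncientMildSolution 1 v →
      (∀ t < 0, MeasureTheory.AEStronglyMeasurable (v t) MeasureTheory.volume) →
      ContDiffOn ℝ (⊤ : ℕ∞) (Function.uncurry v) (Set.Iio 0 ×ˢ Set.univ) →
      ∀ M : ℝ, M ≤ ε →
        (∀ t < 0, ∀ (R : EuclideanSpace ℝ (Fin 3) ≃ₗᵢ[ℝ] EuclideanSpace ℝ (Fin 3)) (c : ℝ),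
          ∫⁻ y : EuclideanSpace ℝ (Fin 2), ‖v t (R (WithLp.toLp 2 ![y 0, y 1, c]))‖ₑ ^ 2 ≤ ENNReal.ofReal M) →
        ∀ t < 0, ∀ x, v t x = 0 := by
  -- the absolute constant
  set K : ℝ := 4 * (2048 * (4 * Real.pi) ^ (-(3 : ℝ) / 2) *
      Real.sqrt ((volume (ball (0 : EuclideanSpace ℝ (Fin 3)) 1)).toReal)) *
    oseenSliceConst (EuclideanSpace ℝ (Fin 3)) with hK
  have hKpos : 0 < K := by
    have hV : 0 < (volume (ball (0 : EuclideanSpace ℝ (Fin 3)) 1)).toReal :=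
      ENNReal.toReal_pos (measure_ball_pos volume _ one_pos).ne' measure_ball_lt_top.ne
    have := oseenSliceConst_pos (E := EuclideanSpace ℝ (Fin 3))
    positivity
  refine ⟨1 / (32 * K ^ 2), by positivity, ?_⟩
  intro v hv hmeas hsm M hMε hpl t ht x
  -- normalise the planar bound
  set M' : ℝ := max M 0 with hM'
  have hM'0 : 0 ≤ M' := le_max_right _ _
  have hM'ε : M' ≤ 1 / (32 * K ^ 2) := max_le hMε (by positivity)
  have hslice : ∀ τ < 0, Continuous (v τ) := fun τ hτ =>
    (contDiff_slice_of_contDiffOn hsm (show τ ∈ Iio 0 from hτ)).continuous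
  have hplM : ∀ τ < 0, ∀ (R : EuclideanSpace ℝ (Fin 3) ≃ₗᵢ[ℝ] EuclideanSpace ℝ (Fin 3)) (c : ℝ),
      ∫⁻ y : EuclideanSpace ℝ (Fin 2), ‖v τ (R (WithLp.toLp 2 ![y 0, y 1, c]))‖ₑ ^ 2 ≤
        ENNReal.ofReal M' :=
    fun τ hτ R c => (hpl τ hτ R c).trans (ENNReal.ofReal_le_ofReal (le_max_left _ _))
  -- step 1: the Morrey bound with constant `I = 2M'`
  have hMor : ∀ τ < 0, ∀ (y : EuclideanSpace ℝ (Fin 3)) (r : ℝ), 0 < r →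
      ∫⁻ z in ball y r, ‖v τ z‖ₑ ^ 2 ≤ ENNReal.ofReal (2 * M' * r) := by
    intro τ hτ y r hr
    have h := PlanarEnergyAPriori.planeEnergyCeiling_scaledEnergyOfPlanar (v τ) (hslice τ hτ) M' hM'0
      (hplM τ hτ) y r hr
    rwa [mul_right_comm] at h
  -- step 2: the Oseen representation
  obtain ⟨hrep, -⟩ := oseenMild_and_morrey_of_planar hv hmeas hsm ⟨M, hpl⟩
  -- step 3: smallness `K √(2M') ≤ 1/4`
  have hI : 0 ≤ 2 * M' := by positivity
  have hsmall : K * Real.sqrt (2 * M') ≤ 1 / 4 := by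
    have h2M : 2 * M' ≤ 1 / (16 * K ^ 2) := by
      calc 2 * M' ≤ 2 * (1 / (32 * K ^ 2)) := by gcongr
        _ = 1 / (16 * K ^ 2) := by ring
    have hsq : Real.sqrt (2 * M') ≤ 1 / (4 * K) := by
      rw [show 1 / (4 * K) = Real.sqrt ((1 / (4 * K)) ^ 2) by rw [Real.sqrt_sq (by positivity)]]
      refine Real.sqrt_le_sqrt (h2M.trans_eq ?_)
      field_simp
      ring
    calc K * Real.sqrt (2 * M') ≤ K * (1 / (4 * K)) := by gcongr
      _ = 1 / 4 := by field_simp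
  -- step 4: iterate from the given bound
  obtain ⟨W₀, hW₀⟩ := hv.2
  have hW₀' : ∀ τ < 0, ∀ y, ‖v τ y‖ ≤ W₀ := fun τ hτ y => hW₀ τ hτ y
  have hpow : ∀ n : ℕ, ‖v t x‖ ≤ (3 / 4 : ℝ) ^ n * W₀ := fun n =>
    norm_le_pow_of_oseen_morrey hrep hmeas hI hMor (by simpa only [hK] using hsmall) hW₀' n t ht x
  have hlim : Tendsto (fun n : ℕ => (3 / 4 : ℝ) ^ n * W₀) atTop (𝓝 (0 * W₀)) :=
    (tendsto_pow_atTop_nhds_zero_of_lt_one (by norm_num) (by norm_num)).mul_const W₀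
  rw [zero_mul] at hlim
  have h0 : ‖v t x‖ ≤ 0 := ge_of_tendsto' hlim hpow
  exact norm_le_zero_iff.1 h0

end Summit.NavierStokesRegularity.NavierStokesRegularity.Theorems.PlaneEnergyCeilingPlanarEnergyLiouville

end
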